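import Mathlib
import Summits.KontsevichZagierPeriods.KontsevichZagierPeriods.Theorems.InverseLandauTateFamilyKernelIsotopyTwo

/-!
# `TateFamilyKernel` — rule (2) along a polynomial isotopy of the CUBE `[0,1]³` is an `m = 1` Ayoub
# certificate (line `Sketch`, stub `stub_isotopyThree`)

Crux `TateFamilyKernel` (stmt-KontsevichZagierPeriods-9130, route `InverseLandau`), line `Sketch`;
the dimension-3 analogue of `stub_isotopyTwo` (file `InverseLandauTateFamilyKernelIsotopyTwo.lean`).
Data: the components `φ₁, φ₂, φ₃ ∈ ℚ[w₀, w₁, w₂, s, ϖ]` (variables `X 0, …, X 4`) of a polynomial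
family `Φ_s = (φ₁, φ₂, φ₃)` of self-maps of the cube sending each face into a face of the same
direction (`φᵢ ≡ cᵢ₀` on `wᵢ₋₁ = 0`, `φᵢ ≡ cᵢ₁` on `wᵢ₋₁ = 1`, as divisibilities), a rational
`h = B/E ∈ ℚ(y₀, y₁, y₂, ϖ)` and a real-algebraic `ϖ₀` with `E(Φ_s(w), ϖ₀) ≠ 0` on `[0,1]⁴`.
Conclusion (`stub_isotopyThree`): every tame cube representation of
`f(z) = h(Φ₁ z)·J₁(z) − h(Φ₀ z)·J₀(z)`, `J = det(∂ⱼφᵢ)` (everything at `ϖ₀`), lies in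
`KZ.relations`.

Proof (Piola / transport identity). With the `3 × 3` minors `M_k` of `(∂ⱼφᵢ)_{i, j ∈ {0,1,2,3}}`
(column `k` deleted; `M₃ = J`), the pulled-back form `Φ^*(h dy₀∧dy₁∧dy₂) = hΦ Σ_k M_k dx^{(k)}` is
closed: `∂₀(hΦM₀) − ∂₁(hΦM₁) + ∂₂(hΦM₂) − ∂_s(hΦJ) = 0`. Cleared of the denominator `E∘Φ` this is
`Iso3.transport`, reduced by the formal chain rule (`Iso3.pderiv_bind₁_four`) to two determinant
facts: `Σ_k (−1)^k ∂_k M_k = 0` (`Iso3.jacobi`, `d(dφ₁∧dφ₂∧dφ₃) = 0`) and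
`Σ_k (−1)^k ∂_kφᵢ M_k = 0` (`Iso3.cramer`, `dφᵢ∧dφ₁∧dφ₂∧dφ₃ = 0`). The face conditions kill `M_k` on
`w_k ∈ {0,1}` (`k = 0, 1, 2`: every term of `M_k` carries a tangential derivative of `φ_{k+1}`), so
on `[0,1]⁴` `f = relA₀(hΦM₀) + relA₁(−hΦM₁) + relA₂(hΦM₂) + relA_s(−hΦJ)`: a four-term instance of
`tame_certificate` with `n = 3`, `m = 1` and rational data of common denominator `E∘Φ`.
References: Kontsevich–Zagier 2001 §1.2 rules (2), (3); Ayoub, EMS Newsl. 91 (2014) Def. 10.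
-/

noncomputable section

open MeasureTheory Set MvPolynomial
open Literature.NumberTheory.Transcendental

namespace Summit.KontsevichZagierPeriods.InverseLandau.TateFamilyKernel.Descent

namespace Iso3

/-! ### Formal calculus on `ℚ[w₀, w₁, w₂, s, ϖ]` -/

/-- Mixed formal partial derivatives commute, `∂ᵢ∂ⱼ = ∂ⱼ∂ᵢ`, on `ℚ[w₀, w₁, w₂, s, ϖ]`. [folklore] -/
theorem pderiv_pderiv_comm (i j : Fin (3 + 1 + 1)) (p : MvPolynomial (Fin (3 + 1 + 1)) ℚ) :
    pderiv i (pderiv j p) = pderiv j (pderiv i p) := by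
  -- adapted from `Iso.pderiv_pderiv_comm` (IsotopyTwo)
  induction p using MvPolynomial.induction_on with
  | C a => simp
  | add p q hp hq => simp [map_add, hp, hq]
  | mul_X p k h =>
    simp only [pderiv_mul, map_add, h, pderiv_X]
    by_cases hik : i = k <;> by_cases hjk : j = k <;> simp [hik, hjk]

/-- The chain rule for the substitution `yᵢ ↦ φᵢ₊₁` (`i = 0, 1, 2`), `ϖ ↦ ϖ` along a direction
`i ≠ 4` (the parameter `ϖ = X 4` is not differentiated):
`∂ᵢ(P∘Φ) = (∂₀P∘Φ)·∂ᵢφ₁ + (∂₁P∘Φ)·∂ᵢφ₂ + (∂₂P∘Φ)·∂ᵢφ₃`. [folklore] -/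
theorem pderiv_bind₁_four (φ₁ φ₂ φ₃ : MvPolynomial (Fin (3 + 1 + 1)) ℚ)
    (P : MvPolynomial (Fin (3 + 1)) ℚ) {i : Fin (3 + 1 + 1)} (hi : (4 : Fin (3 + 1 + 1)) ≠ i) :
    pderiv i (bind₁ ![φ₁, φ₂, φ₃, X 4] P) =
      bind₁ ![φ₁, φ₂, φ₃, X 4] (pderiv 0 P) * pderiv i φ₁ +
        bind₁ ![φ₁, φ₂, φ₃, X 4] (pderiv 1 P) * pderiv i φ₂ +
        bind₁ ![φ₁, φ₂, φ₃, X 4] (pderiv 2 P) * pderiv i φ₃ := by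
  rw [pderiv_bind₁, Fin.sum_univ_four]
  simp only [Matrix.cons_val_zero, Matrix.cons_val_one, Matrix.cons_val_two, Matrix.cons_val_three,
    Matrix.head_cons, Matrix.tail_cons, pderiv_X_of_ne hi, mul_zero, add_zero]

/-- **Closedness of `dφ₁∧dφ₂∧dφ₃`** on `(w₀, w₁, w₂, s)`-space: the alternating divergence of the
four `3 × 3` minors `M₀, M₁, M₂, M₃ = J` of `(∂ⱼφᵢ)` vanishes, `∂₀M₀ − ∂₁M₁ + ∂₂M₂ − ∂₃M₃ = 0`
(commuting mixed partials). [folklore] -/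
theorem jacobi (φ₁ φ₂ φ₃ : MvPolynomial (Fin (3 + 1 + 1)) ℚ) :
    pderiv 0 (pderiv 1 φ₁ * (pderiv 2 φ₂ * pderiv 3 φ₃ - pderiv 3 φ₂ * pderiv 2 φ₃)
        - pderiv 2 φ₁ * (pderiv 1 φ₂ * pderiv 3 φ₃ - pderiv 3 φ₂ * pderiv 1 φ₃)
        + pderiv 3 φ₁ * (pderiv 1 φ₂ * pderiv 2 φ₃ - pderiv 2 φ₂ * pderiv 1 φ₃)) -
      pderiv 1 (pderiv 0 φ₁ * (pderiv 2 φ₂ * pderiv 3 φ₃ - pderiv 3 φ₂ * pderiv 2 φ₃)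
        - pderiv 2 φ₁ * (pderiv 0 φ₂ * pderiv 3 φ₃ - pderiv 3 φ₂ * pderiv 0 φ₃)
        + pderiv 3 φ₁ * (pderiv 0 φ₂ * pderiv 2 φ₃ - pderiv 2 φ₂ * pderiv 0 φ₃)) +
      pderiv 2 (pderiv 0 φ₁ * (pderiv 1 φ₂ * pderiv 3 φ₃ - pderiv 3 φ₂ * pderiv 1 φ₃)
        - pderiv 1 φ₁ * (pderiv 0 φ₂ * pderiv 3 φ₃ - pderiv 3 φ₂ * pderiv 0 φ₃)
        + pderiv 3 φ₁ * (pderiv 0 φ₂ * pderiv 1 φ₃ - pderiv 1 φ₂ * pderiv 0 φ₃)) -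
      pderiv 3 (pderiv 0 φ₁ * (pderiv 1 φ₂ * pderiv 2 φ₃ - pderiv 2 φ₂ * pderiv 1 φ₃)
        - pderiv 1 φ₁ * (pderiv 0 φ₂ * pderiv 2 φ₃ - pderiv 2 φ₂ * pderiv 0 φ₃)
        + pderiv 2 φ₁ * (pderiv 0 φ₂ * pderiv 1 φ₃ - pderiv 1 φ₂ * pderiv 0 φ₃)) = 0 := by
  simp only [map_sub, map_add, pderiv_mul, pderiv_pderiv_comm 1 0, pderiv_pderiv_comm 2 0,
    pderiv_pderiv_comm 3 0, pderiv_pderiv_comm 2 1, pderiv_pderiv_comm 3 1, pderiv_pderiv_comm 3 2]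
  ring

/-- **A `4 × 4` Jacobian determinant with a repeated row vanishes**: for `g ∈ {φ₁, φ₂, φ₃}`,
`∂₀g·M₀ − ∂₁g·M₁ + ∂₂g·M₂ − ∂₃g·M₃ = 0` (`dg∧dφ₁∧dφ₂∧dφ₃ = 0`). [folklore] -/
theorem cramer (φ₁ φ₂ φ₃ g : MvPolynomial (Fin (3 + 1 + 1)) ℚ) (hg : g = φ₁ ∨ g = φ₂ ∨ g = φ₃) :
    pderiv 0 g * (pderiv 1 φ₁ * (pderiv 2 φ₂ * pderiv 3 φ₃ - pderiv 3 φ₂ * pderiv 2 φ₃)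
        - pderiv 2 φ₁ * (pderiv 1 φ₂ * pderiv 3 φ₃ - pderiv 3 φ₂ * pderiv 1 φ₃)
        + pderiv 3 φ₁ * (pderiv 1 φ₂ * pderiv 2 φ₃ - pderiv 2 φ₂ * pderiv 1 φ₃)) -
      pderiv 1 g * (pderiv 0 φ₁ * (pderiv 2 φ₂ * pderiv 3 φ₃ - pderiv 3 φ₂ * pderiv 2 φ₃)
        - pderiv 2 φ₁ * (pderiv 0 φ₂ * pderiv 3 φ₃ - pderiv 3 φ₂ * pderiv 0 φ₃)
        + pderiv 3 φ₁ * (pderiv 0 φ₂ * pderiv 2 φ₃ - pderiv 2 φ₂ * pderiv 0 φ₃)) +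
      pderiv 2 g * (pderiv 0 φ₁ * (pderiv 1 φ₂ * pderiv 3 φ₃ - pderiv 3 φ₂ * pderiv 1 φ₃)
        - pderiv 1 φ₁ * (pderiv 0 φ₂ * pderiv 3 φ₃ - pderiv 3 φ₂ * pderiv 0 φ₃)
        + pderiv 3 φ₁ * (pderiv 0 φ₂ * pderiv 1 φ₃ - pderiv 1 φ₂ * pderiv 0 φ₃)) -
      pderiv 3 g * (pderiv 0 φ₁ * (pderiv 1 φ₂ * pderiv 2 φ₃ - pderiv 2 φ₂ * pderiv 1 φ₃)
        - pderiv 1 φ₁ * (pderiv 0 φ₂ * pderiv 2 φ₃ - pderiv 2 φ₂ * pderiv 0 φ₃)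
        + pderiv 2 φ₁ * (pderiv 0 φ₂ * pderiv 1 φ₃ - pderiv 1 φ₂ * pderiv 0 φ₃)) = 0 := by
  rcases hg with rfl | rfl | rfl <;> ring

/-- **The transport identity** cleared of denominators: with `hΦ = BΦ/EΦ`, the chain rules
`∂ᵢBΦ = B₀∂ᵢφ₁ + B₁∂ᵢφ₂ + B₂∂ᵢφ₃`, `∂ᵢEΦ = E₀∂ᵢφ₁ + E₁∂ᵢφ₂ + E₂∂ᵢφ₃` (`i ≠ 4`) and minors `M_k`
satisfying `jacobi` and `cramer`, the four quotient-rule numerators of `∂₀(hΦM₀)`, `∂₁(−hΦM₁)`,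
`∂₂(hΦM₂)`, `∂₃(−hΦM₃)` sum to zero — `d(Φ^*(h dy₀∧dy₁∧dy₂)) = Φ^* d(h dy₀∧dy₁∧dy₂) = 0`.
[folklore] -/
theorem transport {φ₁ φ₂ φ₃ BΦ EΦ B₀ B₁ B₂ E₀ E₁ E₂ M₀ M₁ M₂ M₃ : MvPolynomial (Fin (3 + 1 + 1)) ℚ}
    (hB : ∀ i : Fin (3 + 1 + 1), (4 : Fin (3 + 1 + 1)) ≠ i →
      pderiv i BΦ = B₀ * pderiv i φ₁ + B₁ * pderiv i φ₂ + B₂ * pderiv i φ₃)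
    (hE : ∀ i : Fin (3 + 1 + 1), (4 : Fin (3 + 1 + 1)) ≠ i →
      pderiv i EΦ = E₀ * pderiv i φ₁ + E₁ * pderiv i φ₂ + E₂ * pderiv i φ₃)
    (hjac : pderiv 0 M₀ - pderiv 1 M₁ + pderiv 2 M₂ - pderiv 3 M₃ = 0)
    (h₁ : pderiv 0 φ₁ * M₀ - pderiv 1 φ₁ * M₁ + pderiv 2 φ₁ * M₂ - pderiv 3 φ₁ * M₃ = 0)
    (h₂ : pderiv 0 φ₂ * M₀ - pderiv 1 φ₂ * M₁ + pderiv 2 φ₂ * M₂ - pderiv 3 φ₂ * M₃ = 0)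
    (h₃ : pderiv 0 φ₃ * M₀ - pderiv 1 φ₃ * M₁ + pderiv 2 φ₃ * M₂ - pderiv 3 φ₃ * M₃ = 0) :
    pderiv 0 (BΦ * M₀) * EΦ - BΦ * M₀ * pderiv 0 EΦ +
      (pderiv 1 (-(BΦ * M₁)) * EΦ - (-(BΦ * M₁)) * pderiv 1 EΦ) +
      (pderiv 2 (BΦ * M₂) * EΦ - BΦ * M₂ * pderiv 2 EΦ) +
      (pderiv 3 (-(BΦ * M₃)) * EΦ - (-(BΦ * M₃)) * pderiv 3 EΦ) = 0 := by
  have h0 : (4 : Fin (3 + 1 + 1)) ≠ 0 := by decide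
  have h1 : (4 : Fin (3 + 1 + 1)) ≠ 1 := by decide
  have h2 : (4 : Fin (3 + 1 + 1)) ≠ 2 := by decide
  have h3 : (4 : Fin (3 + 1 + 1)) ≠ 3 := by decide
  simp only [map_neg, pderiv_mul, hB 0 h0, hB 1 h1, hB 2 h2, hB 3 h3, hE 0 h0, hE 1 h1, hE 2 h2,
    hE 3 h3]
  linear_combination (EΦ * BΦ) * hjac + (EΦ * B₀ - BΦ * E₀) * h₁ + (EΦ * B₁ - BΦ * E₁) * h₂ +
    (EΦ * B₂ - BΦ * E₂) * h₃

/-! ### Faces and the double slice `z ↦ (z, c, ϖ₀)` -/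

/-- On the face `wᵢ = 0` of a component `φ = c + wᵢ·R`, every other partial `∂ⱼφ`, `j ≠ i`,
vanishes. [folklore] -/
theorem face_zero {N : ℕ} {φ R : MvPolynomial (Fin N) ℚ} {c : ℚ} {i j : Fin N}
    (hφ : φ = C c + X i * R) (hij : i ≠ j) {v : Fin N → ℝ} (hv : v i = 0) :
    aeval v (pderiv j φ) = 0 :=
  Iso.aeval_pderiv_eq_zero_of_eq hφ (pderiv_X_of_ne hij) (by rw [aeval_X, hv])

/-- On the face `wᵢ = 1` of a component `φ = c + (1 − wᵢ)·R`, every other partial `∂ⱼφ`, `j ≠ i`,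
vanishes. [folklore] -/
theorem face_one {N : ℕ} {φ R : MvPolynomial (Fin N) ℚ} {c : ℚ} {i j : Fin N}
    (hφ : φ = C c + (1 - X i) * R) (hij : i ≠ j) {v : Fin N → ℝ} (hv : v i = 1) :
    aeval v (pderiv j φ) = 0 :=
  Iso.aeval_pderiv_eq_zero_of_eq hφ (by rw [map_sub, pderiv_one, pderiv_X_of_ne hij, sub_zero])
    (by rw [map_sub, map_one, aeval_X, hv, sub_self])

/-- The `i`-th coordinate (`i < 4`) of `(w|_{wᵢ ↦ c}, ϖ₀)` is `c`. [folklore] -/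
theorem snoc_update_apply (w : Fin (3 + 1) → ℝ) (i : Fin (3 + 1)) (c ϖ₀ : ℝ) :
    (Fin.snoc (Function.update w i c) ϖ₀ : Fin (3 + 1 + 1) → ℝ) (Fin.castSucc i) = c := by
  rw [Fin.snoc_castSucc, Function.update_self]

/-- Reading `(w₀, w₁, w₂, c, ϖ₀)` either as the slice at `ϖ₀` of `w` with `s` frozen at `c`, or as
the double slice of `z = (w₀, w₁, w₂)`. [folklore] -/
theorem snoc_update_three (w : Fin (3 + 1) → ℝ) (c ϖ₀ : ℝ) :
    (Fin.snoc (Function.update w 3 c) ϖ₀ : Fin (3 + 1 + 1) → ℝ) =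
      Fin.snoc (Fin.snoc (fun j : Fin 3 => w (Fin.castAdd 1 j)) c : Fin (3 + 1) → ℝ) ϖ₀ := by
  -- adapted from `Iso.snoc_update_two` (IsotopyTwo)
  congr 1
  ext j
  refine Fin.lastCases ?_ (fun i => ?_) j
  · rw [Fin.snoc_last]
    exact Function.update_self ..
  · have hi : Fin.castSucc i ≠ (3 : Fin (3 + 1)) := ne_of_lt (Fin.castSucc_lt_last i)
    rw [Fin.snoc_castSucc, Function.update_of_ne hi]
    rfl

end Iso3

open Iso Iso3 in
/-- STUB `stub_isotopyThree` of line `Sketch` — **rule (2) along a polynomial ISOTOPY is an `m = 1`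
Ayoub certificate, dimension 3.** Data: the components `φ₁, φ₂, φ₃ ∈ ℚ[w₀, w₁, w₂, s, ϖ]` of a
polynomial family `Φ_s = (φ₁, φ₂, φ₃)` of self-maps of the cube which sends each face into a face of
the same direction (`φ₁ ≡ c₁₀` on `w₀ = 0`, `φ₁ ≡ c₁₁` on `w₀ = 1`, `φ₂ ≡ c₂₀` on `w₁ = 0`,
`φ₂ ≡ c₂₁` on `w₁ = 1`, `φ₃ ≡ c₃₀` on `w₂ = 0`, `φ₃ ≡ c₃₁` on `w₂ = 1`, stated as divisibilities),
and `h = B/E ∈ ℚ(y₀, y₁, y₂, ϖ)` with `E(Φ_s(w), ϖ₀) ≠ 0` on `[0,1]⁴` (`w = (w₀, w₁, w₂, s)`, `ϖ₀`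
real algebraic). Conclusion: every tame cube representation of
`f(z) = h(Φ₁ z)·J₁(z) − h(Φ₀ z)·J₀(z)` (`J_s = det(∂ⱼφᵢ)_{j = 0,1,2}`, everything at `ϖ₀`) is a
relation.
Proof: the transport identity `∂_s(h(Φ)J) = ∂₀(h(Φ)M₀) − ∂₁(h(Φ)M₁) + ∂₂(h(Φ)M₂)`
(`Iso3.transport` + `Iso3.jacobi` + `Iso3.cramer`), the face conditions `M_k|_{w_k∈{0,1}} = 0`
(`k = 0, 1, 2`), hence on `[0,1]⁴`
`f(z) = relA₀(h(Φ)M₀) + relA₁(−h(Φ)M₁) + relA₂(h(Φ)M₂) + relA_s(−h(Φ)J)` — `tame_certificate` with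
`n = 3`, `m = 1`, four terms, rational data with denominator `E∘Φ`.
[cite: KontsevichZagier2001, §1.2 rules (2), (3)] [cite: Ayoub2014, Def. 10] -/
theorem stub_isotopyThree (φ₁ φ₂ φ₃ : MvPolynomial (Fin (3 + 1 + 1)) ℚ) (B E : MvPolynomial (Fin (3 + 1)) ℚ)
    (c₁₀ c₁₁ c₂₀ c₂₁ c₃₀ c₃₁ : ℚ)
    (h10 : ∃ R : MvPolynomial (Fin (3 + 1 + 1)) ℚ, φ₁ = C c₁₀ + X 0 * R)
    (h11 : ∃ R : MvPolynomial (Fin (3 + 1 + 1)) ℚ, φ₁ = C c₁₁ + (1 - X 0) * R)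
    (h20 : ∃ R : MvPolynomial (Fin (3 + 1 + 1)) ℚ, φ₂ = C c₂₀ + X 1 * R)
    (h21 : ∃ R : MvPolynomial (Fin (3 + 1 + 1)) ℚ, φ₂ = C c₂₁ + (1 - X 1) * R)
    (h30 : ∃ R : MvPolynomial (Fin (3 + 1 + 1)) ℚ, φ₃ = C c₃₀ + X 2 * R)
    (h31 : ∃ R : MvPolynomial (Fin (3 + 1 + 1)) ℚ, φ₃ = C c₃₁ + (1 - X 2) * R)
    (ϖ₀ : ℝ) (halg : IsAlgebraic ℚ ϖ₀)
    (hE : ∀ w ∈ KZ.cube (3 + 1), aeval (Fin.snoc w ϖ₀ : Fin (3 + 1 + 1) → ℝ)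
      (bind₁ ![φ₁, φ₂, φ₃, X 4] E) ≠ 0) :
    ∀ R : KZ.IntegralRep 3, R.IsTameCube →
      (∀ z ∈ KZ.cube 3, R.integrand z =
        aeval (Fin.snoc (Fin.snoc z 1) ϖ₀ : Fin (3 + 1 + 1) → ℝ) (bind₁ ![φ₁, φ₂, φ₃, X 4] B) /
              aeval (Fin.snoc (Fin.snoc z 1) ϖ₀ : Fin (3 + 1 + 1) → ℝ) (bind₁ ![φ₁, φ₂, φ₃, X 4] E) *
            aeval (Fin.snoc (Fin.snoc z 1) ϖ₀ : Fin (3 + 1 + 1) → ℝ)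
              (pderiv 0 φ₁ * (pderiv 1 φ₂ * pderiv 2 φ₃ - pderiv 2 φ₂ * pderiv 1 φ₃)
                - pderiv 1 φ₁ * (pderiv 0 φ₂ * pderiv 2 φ₃ - pderiv 2 φ₂ * pderiv 0 φ₃)
                + pderiv 2 φ₁ * (pderiv 0 φ₂ * pderiv 1 φ₃ - pderiv 1 φ₂ * pderiv 0 φ₃)) -
          aeval (Fin.snoc (Fin.snoc z 0) ϖ₀ : Fin (3 + 1 + 1) → ℝ) (bind₁ ![φ₁, φ₂, φ₃, X 4] B) /
              aeval (Fin.snoc (Fin.snoc z 0) ϖ₀ : Fin (3 + 1 + 1) → ℝ) (bind₁ ![φ₁, φ₂, φ₃, X 4] E) *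
            aeval (Fin.snoc (Fin.snoc z 0) ϖ₀ : Fin (3 + 1 + 1) → ℝ)
              (pderiv 0 φ₁ * (pderiv 1 φ₂ * pderiv 2 φ₃ - pderiv 2 φ₂ * pderiv 1 φ₃)
                - pderiv 1 φ₁ * (pderiv 0 φ₂ * pderiv 2 φ₃ - pderiv 2 φ₂ * pderiv 0 φ₃)
                + pderiv 2 φ₁ * (pderiv 0 φ₂ * pderiv 1 φ₃ - pderiv 1 φ₂ * pderiv 0 φ₃))) →
      KZ.of R ∈ KZ.relations := by
  intro R hR hRi
  obtain ⟨P₁, hP₁⟩ := h10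
  obtain ⟨P₁', hP₁'⟩ := h11
  obtain ⟨P₂, hP₂⟩ := h20
  obtain ⟨P₂', hP₂'⟩ := h21
  obtain ⟨P₃, hP₃⟩ := h30
  obtain ⟨P₃', hP₃'⟩ := h31
  -- names for the certificate data (`X 0, X 1, X 2 = w`, `X 3 = s`, `X 4 = ϖ`)
  set EΦ : MvPolynomial (Fin (3 + 1 + 1)) ℚ := bind₁ ![φ₁, φ₂, φ₃, X 4] E with hEΦ
  set BΦ : MvPolynomial (Fin (3 + 1 + 1)) ℚ := bind₁ ![φ₁, φ₂, φ₃, X 4] B with hBΦ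
  set M₀ : MvPolynomial (Fin (3 + 1 + 1)) ℚ :=
    pderiv 1 φ₁ * (pderiv 2 φ₂ * pderiv 3 φ₃ - pderiv 3 φ₂ * pderiv 2 φ₃)
      - pderiv 2 φ₁ * (pderiv 1 φ₂ * pderiv 3 φ₃ - pderiv 3 φ₂ * pderiv 1 φ₃)
      + pderiv 3 φ₁ * (pderiv 1 φ₂ * pderiv 2 φ₃ - pderiv 2 φ₂ * pderiv 1 φ₃) with hM₀
  set M₁ : MvPolynomial (Fin (3 + 1 + 1)) ℚ :=
    pderiv 0 φ₁ * (pderiv 2 φ₂ * pderiv 3 φ₃ - pderiv 3 φ₂ * pderiv 2 φ₃)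
      - pderiv 2 φ₁ * (pderiv 0 φ₂ * pderiv 3 φ₃ - pderiv 3 φ₂ * pderiv 0 φ₃)
      + pderiv 3 φ₁ * (pderiv 0 φ₂ * pderiv 2 φ₃ - pderiv 2 φ₂ * pderiv 0 φ₃) with hM₁
  set M₂ : MvPolynomial (Fin (3 + 1 + 1)) ℚ :=
    pderiv 0 φ₁ * (pderiv 1 φ₂ * pderiv 3 φ₃ - pderiv 3 φ₂ * pderiv 1 φ₃)
      - pderiv 1 φ₁ * (pderiv 0 φ₂ * pderiv 3 φ₃ - pderiv 3 φ₂ * pderiv 0 φ₃)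
      + pderiv 3 φ₁ * (pderiv 0 φ₂ * pderiv 1 φ₃ - pderiv 1 φ₂ * pderiv 0 φ₃) with hM₂
  set M₃ : MvPolynomial (Fin (3 + 1 + 1)) ℚ :=
    pderiv 0 φ₁ * (pderiv 1 φ₂ * pderiv 2 φ₃ - pderiv 2 φ₂ * pderiv 1 φ₃)
      - pderiv 1 φ₁ * (pderiv 0 φ₂ * pderiv 2 φ₃ - pderiv 2 φ₂ * pderiv 0 φ₃)
      + pderiv 2 φ₁ * (pderiv 0 φ₂ * pderiv 1 φ₃ - pderiv 1 φ₂ * pderiv 0 φ₃) with hM₃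
  -- the transport identity for the substituted numerator and denominator `B∘Φ`, `E∘Φ`
  have key := transport (M₀ := M₀) (M₁ := M₁) (M₂ := M₂) (M₃ := M₃)
    (fun i hi => pderiv_bind₁_four φ₁ φ₂ φ₃ B hi) (fun i hi => pderiv_bind₁_four φ₁ φ₂ φ₃ E hi)
    (jacobi φ₁ φ₂ φ₃) (cramer φ₁ φ₂ φ₃ φ₁ (Or.inl rfl)) (cramer φ₁ φ₂ φ₃ φ₂ (Or.inr (Or.inl rfl)))
    (cramer φ₁ φ₂ φ₃ φ₃ (Or.inr (Or.inr rfl)))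
  set A₀ : MvPolynomial (Fin (3 + 1 + 1)) ℚ := BΦ * M₀ with hA₀
  set A₁ : MvPolynomial (Fin (3 + 1 + 1)) ℚ := -(BΦ * M₁) with hA₁
  set A₂ : MvPolynomial (Fin (3 + 1 + 1)) ℚ := BΦ * M₂ with hA₂
  set A₃ : MvPolynomial (Fin (3 + 1 + 1)) ℚ := -(BΦ * M₃) with hA₃
  -- the common denominator `E∘Φ` does not vanish on the closed cube, nor on its `s`-faces
  have hE2 : ∀ w ∈ KZ.cube (3 + 1), aeval (Fin.snoc w ϖ₀ : Fin (3 + 1 + 1) → ℝ) (EΦ ^ 2) ≠ 0 :=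
    fun w hw => by rw [map_pow]; exact pow_ne_zero 2 (hE w hw)
  have hEc : ∀ c ∈ Icc (0 : ℝ) 1, ∀ z ∈ KZ.cube 3,
      aeval (Fin.snoc (Fin.snoc z c : Fin (3 + 1) → ℝ) ϖ₀ : Fin (3 + 1 + 1) → ℝ) EΦ ≠ 0 :=
    fun c hc z hz => hE _ (KZ.snoc_mem_cube_iff.2 ⟨hz, hc.1, hc.2⟩)
  have h0m : (0 : ℝ) ∈ Icc (0 : ℝ) 1 := ⟨le_rfl, zero_le_one⟩
  have h1m : (1 : ℝ) ∈ Icc (0 : ℝ) 1 := ⟨zero_le_one, le_rfl⟩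
  have hc2 : (Fin.castSucc (2 : Fin (3 + 1)) : Fin (3 + 1 + 1)) = 2 := rfl
  have hc3 : (Fin.castSucc (3 : Fin (3 + 1)) : Fin (3 + 1 + 1)) = 3 := rfl
  -- face vanishing of `M₀` on `w₀ ∈ {0,1}`, `M₁` on `w₁ ∈ {0,1}`, `M₂` on `w₂ ∈ {0,1}`
  have hA₀v : ∀ v : Fin (3 + 1 + 1) → ℝ, aeval v (pderiv 1 φ₁) = 0 → aeval v (pderiv 2 φ₁) = 0 →
      aeval v (pderiv 3 φ₁) = 0 → aeval v A₀ = 0 := fun v h1 h2 h3 => by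
    simp only [hA₀, hM₀, map_mul, map_sub, map_add, h1, h2, h3, zero_mul, sub_zero, add_zero,
      mul_zero]
  have hA₁v : ∀ v : Fin (3 + 1 + 1) → ℝ, aeval v (pderiv 0 φ₂) = 0 → aeval v (pderiv 2 φ₂) = 0 →
      aeval v (pderiv 3 φ₂) = 0 → aeval v A₁ = 0 := fun v h1 h2 h3 => by
    simp only [hA₁, hM₁, map_neg, map_mul, map_sub, map_add, h1, h2, h3, zero_mul, mul_zero,
      sub_zero, add_zero, neg_zero]
  have hA₂v : ∀ v : Fin (3 + 1 + 1) → ℝ, aeval v (pderiv 0 φ₃) = 0 → aeval v (pderiv 1 φ₃) = 0 →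
      aeval v (pderiv 3 φ₃) = 0 → aeval v A₂ = 0 := fun v h1 h2 h3 => by
    simp only [hA₂, hM₂, map_mul, map_sub, map_add, h1, h2, h3, mul_zero, sub_zero, add_zero]
  have n01 : (0 : Fin (3 + 1 + 1)) ≠ 1 := by decide
  have n02 : (0 : Fin (3 + 1 + 1)) ≠ 2 := by decide
  have n03 : (0 : Fin (3 + 1 + 1)) ≠ 3 := by decide
  have n10 : (1 : Fin (3 + 1 + 1)) ≠ 0 := by decide
  have n12 : (1 : Fin (3 + 1 + 1)) ≠ 2 := by decide
  have n13 : (1 : Fin (3 + 1 + 1)) ≠ 3 := by decide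
  have n20 : (2 : Fin (3 + 1 + 1)) ≠ 0 := by decide
  have n21 : (2 : Fin (3 + 1 + 1)) ≠ 1 := by decide
  have n23 : (2 : Fin (3 + 1 + 1)) ≠ 3 := by decide
  refine tame_certificate (n := 3) (m := 1) (Finset.univ : Finset (Fin 4))
    (![0, 1, 2, 3] : Fin 4 → Fin (3 + 1))
    (f := fun z : Fin 3 → ℝ =>
      aeval (Fin.snoc (Fin.snoc z 0 : Fin (3 + 1) → ℝ) ϖ₀ : Fin (3 + 1 + 1) → ℝ) A₃ /
          aeval (Fin.snoc (Fin.snoc z 0 : Fin (3 + 1) → ℝ) ϖ₀ : Fin (3 + 1 + 1) → ℝ) EΦ -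
        aeval (Fin.snoc (Fin.snoc z 1 : Fin (3 + 1) → ℝ) ϖ₀ : Fin (3 + 1 + 1) → ℝ) A₃ /
          aeval (Fin.snoc (Fin.snoc z 1 : Fin (3 + 1) → ℝ) ϖ₀ : Fin (3 + 1 + 1) → ℝ) EΦ)
    (fun z hz => (analyticAt_aeval_div_aeval_snoc_snoc 0 ϖ₀ A₃ EΦ (hEc 0 h0m z hz)).sub
      (analyticAt_aeval_div_aeval_snoc_snoc 1 ϖ₀ A₃ EΦ (hEc 1 h1m z hz)))
    (IsSemialgebraicFunOn.sub_holds
      (isSemialgebraicFunOn_aeval_div_aeval_comp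
        (isSemialgebraicMapOn_snoc_snoc KZ.isSemialgebraic_cube isAlgebraic_zero halg) A₃ EΦ
        (hEc 0 h0m))
      (isSemialgebraicFunOn_aeval_div_aeval_comp
        (isSemialgebraicMapOn_snoc_snoc KZ.isSemialgebraic_cube isAlgebraic_one halg) A₃ EΦ
        (hEc 1 h1m)))
    (G := fun k w => aeval (Fin.snoc w ϖ₀ : Fin (3 + 1 + 1) → ℝ)
        ((![A₀, A₁, A₂, A₃] : Fin 4 → _) k) /
      aeval (Fin.snoc w ϖ₀ : Fin (3 + 1 + 1) → ℝ) EΦ)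
    (G' := fun k w => aeval (Fin.snoc w ϖ₀ : Fin (3 + 1 + 1) → ℝ)
        (pderiv (Fin.castSucc ((![0, 1, 2, 3] : Fin 4 → Fin (3 + 1)) k))
            ((![A₀, A₁, A₂, A₃] : Fin 4 → _) k) * EΦ -
          (![A₀, A₁, A₂, A₃] : Fin 4 → _) k *
            pderiv (Fin.castSucc ((![0, 1, 2, 3] : Fin 4 → Fin (3 + 1)) k)) EΦ) /
      aeval (Fin.snoc w ϖ₀ : Fin (3 + 1 + 1) → ℝ) (EΦ ^ 2))
    (fun k _ => analyticOnNhd_slice _ EΦ ϖ₀ hE)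
    (fun k _ => isSemialgebraicFunOn_slice _ EΦ halg hE)
    (fun k _ => analyticOnNhd_slice _ _ ϖ₀ hE2)
    (fun k _ => isSemialgebraicFunOn_slice _ _ halg hE2)
    (fun k _ w hw => hasDerivAt_slice_update _ EΦ ϖ₀ _ w (hE w hw))
    (fun w hw => ?_) R hR (fun z hz => ?_)
  · -- the pointwise certificate identity on `[0,1]⁴`
    simp only [Fin.sum_univ_four, Matrix.cons_val_zero, Matrix.cons_val_one, Matrix.cons_val_two,
      Matrix.cons_val_three, Matrix.head_cons, Matrix.tail_cons, Fin.castSucc_zero,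
      Fin.castSucc_one, hc2, hc3]
    -- the faces `w_k ∈ {0,1}` of `A_k/EΦ` vanish (`k = 0, 1, 2`)
    have f00 : aeval (Fin.snoc (Function.update w 0 0) ϖ₀ : Fin (3 + 1 + 1) → ℝ) A₀ = 0 :=
      hA₀v _ (face_zero hP₁ n01 (snoc_update_apply w 0 0 ϖ₀))
        (face_zero hP₁ n02 (snoc_update_apply w 0 0 ϖ₀))
        (face_zero hP₁ n03 (snoc_update_apply w 0 0 ϖ₀))
    have f01 : aeval (Fin.snoc (Function.update w 0 1) ϖ₀ : Fin (3 + 1 + 1) → ℝ) A₀ = 0 :=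
      hA₀v _ (face_one hP₁' n01 (snoc_update_apply w 0 1 ϖ₀))
        (face_one hP₁' n02 (snoc_update_apply w 0 1 ϖ₀))
        (face_one hP₁' n03 (snoc_update_apply w 0 1 ϖ₀))
    have f10 : aeval (Fin.snoc (Function.update w 1 0) ϖ₀ : Fin (3 + 1 + 1) → ℝ) A₁ = 0 :=
      hA₁v _ (face_zero hP₂ n10 (snoc_update_apply w 1 0 ϖ₀))
        (face_zero hP₂ n12 (snoc_update_apply w 1 0 ϖ₀))
        (face_zero hP₂ n13 (snoc_update_apply w 1 0 ϖ₀))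
    have f11 : aeval (Fin.snoc (Function.update w 1 1) ϖ₀ : Fin (3 + 1 + 1) → ℝ) A₁ = 0 :=
      hA₁v _ (face_one hP₂' n10 (snoc_update_apply w 1 1 ϖ₀))
        (face_one hP₂' n12 (snoc_update_apply w 1 1 ϖ₀))
        (face_one hP₂' n13 (snoc_update_apply w 1 1 ϖ₀))
    have f20 : aeval (Fin.snoc (Function.update w 2 0) ϖ₀ : Fin (3 + 1 + 1) → ℝ) A₂ = 0 :=
      hA₂v _ (face_zero hP₃ n20 (snoc_update_apply w 2 0 ϖ₀))
        (face_zero hP₃ n21 (snoc_update_apply w 2 0 ϖ₀))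
        (face_zero hP₃ n23 (snoc_update_apply w 2 0 ϖ₀))
    have f21 : aeval (Fin.snoc (Function.update w 2 1) ϖ₀ : Fin (3 + 1 + 1) → ℝ) A₂ = 0 :=
      hA₂v _ (face_one hP₃' n20 (snoc_update_apply w 2 1 ϖ₀))
        (face_one hP₃' n21 (snoc_update_apply w 2 1 ϖ₀))
        (face_one hP₃' n23 (snoc_update_apply w 2 1 ϖ₀))
    rw [f00, f01, f10, f11, f20, f21, zero_div, zero_div, zero_div]
    -- the derivative parts sum to zero by the transport identity
    have hsum : aeval (Fin.snoc w ϖ₀ : Fin (3 + 1 + 1) → ℝ) (pderiv 0 A₀ * EΦ - A₀ * pderiv 0 EΦ) /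
          aeval (Fin.snoc w ϖ₀ : Fin (3 + 1 + 1) → ℝ) (EΦ ^ 2) +
        aeval (Fin.snoc w ϖ₀ : Fin (3 + 1 + 1) → ℝ) (pderiv 1 A₁ * EΦ - A₁ * pderiv 1 EΦ) /
          aeval (Fin.snoc w ϖ₀ : Fin (3 + 1 + 1) → ℝ) (EΦ ^ 2) +
        aeval (Fin.snoc w ϖ₀ : Fin (3 + 1 + 1) → ℝ) (pderiv 2 A₂ * EΦ - A₂ * pderiv 2 EΦ) /
          aeval (Fin.snoc w ϖ₀ : Fin (3 + 1 + 1) → ℝ) (EΦ ^ 2) +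
        aeval (Fin.snoc w ϖ₀ : Fin (3 + 1 + 1) → ℝ) (pderiv 3 A₃ * EΦ - A₃ * pderiv 3 EΦ) /
          aeval (Fin.snoc w ϖ₀ : Fin (3 + 1 + 1) → ℝ) (EΦ ^ 2) = 0 := by
      rw [← add_div, ← add_div, ← add_div, ← map_add, ← map_add, ← map_add, key, map_zero,
        zero_div]
    -- the `s`-faces of `−hΦ·J = A₃/EΦ` are the two terms of `f`
    rw [snoc_update_three w 1 ϖ₀, snoc_update_three w 0 ϖ₀]
    linear_combination -hsum
  · -- the integrand is `f`
    rw [hRi z hz]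
    simp only [hA₃, map_neg, map_mul]
    ring

end Summit.KontsevichZagierPeriods.InverseLandau.TateFamilyKernel.Descent
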